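import Mathlib

/-!
# Route BarrierLever — item `PartitionMinorsHitByVP` (stmt-ValiantsHypothesis-19717), line `hidden-states`:
# BLOCK-KRONECKER INVERSES for co-star tables — «explicit block ⊗ (1 1; 1 2)^{⊗ rest}»

Helper file (`--supports stmt-ValiantsHypothesis-19717`; cell valiant-natproofs, rung V4, 𝒟-side door (c); prover seat val-np-p6 gen 10).
Definition-free, Mathlib-only; closes NO item. Toolkit for the BLOCK REDUCTION of the co-star conjecture (memo HOME/val-np-p6/g10 §10): a co-star
table that is an arbitrary block on a coordinate set `B` and the identity («state ↦ its own coordinate», base 1) off `B` has a design matrix on ALL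
`2^h` rows/columns of the form
  `E S J = eB (S ∩ B) (J ∩ B) · ∏_{x ∈ S \ B} (if x ∈ J then 2 else 1)`,
and `blockInverse_mul`: if `eiB` inverts `eB` on the subsets of `B` (`Σ_{P ⊆ B} eiB Q P · eB P Q' = [Q = Q']` for `Q, Q' ⊆ B`, and `eB P Q` depends on
`Q` only through `Q ∩ B`), then
  `Ei J S := eiB (J ∩ B) (S ∩ B) · ∏_{x ∈ S \ B} (if x ∈ J then 1 else −1) · ∏_{x ∉ S ∪ B} (if x ∈ J then −1 else 2)`
is a two-sided… a LEFT inverse: `Σ_S Ei J S · E S J' = [J = J']`. (For `B = ∅`, `eB = eiB = 1` this is `CoStar.coStar_inv_mul`, p614189.) Feeding `Ei`'s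
rows at the missing columns into `CoStar.det_submatrix_ne_zero_of_dual` (`…CoStarEngine`) reduces any block-table co-star certificate to a finite
identity on `2^{|B|}` patterns plus one small determinant.

WHAT THIS IS NOT: no certificate is produced here; nothing on crux 14610 or VP ≠ VNP.
-/

set_option linter.dupNamespace false

namespace Summit.ValiantsHypothesis.ValiantsHypothesis.Theorems.BarrierLever.HiddenStates

open Finset Matrix

namespace CoStar

variable {h : ℕ}

/-- Splitting a sum over all subsets of `Fin h` along a block `B`: `S ↦ (S ∩ B, S \ B)`. -/
theorem sum_split_block (B : Finset (Fin h)) (F : Finset (Fin h) → ℂ) :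
    ∑ S : Finset (Fin h), F S = ∑ P ∈ B.powerset, ∑ R ∈ Bᶜ.powerset, F (P ∪ R) := by
  classical
  rw [← Finset.sum_product (s := B.powerset) (t := Bᶜ.powerset) (f := fun x => F (x.1 ∪ x.2))]
  refine Finset.sum_nbij' (fun S => (S ∩ B, S \ B)) (fun x => x.1 ∪ x.2) ?_ ?_ ?_ ?_ ?_
  · intro S _
    rw [Finset.mem_product, Finset.mem_powerset, Finset.mem_powerset]
    exact ⟨Finset.inter_subset_right, fun x hx => Finset.mem_compl.mpr (Finset.mem_sdiff.mp hx).2⟩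
  · intro x _; exact Finset.mem_univ _
  · intro S _
    show S ∩ B ∪ S \ B = S
    rw [Finset.union_comm]
    exact Finset.sdiff_union_inter S B
  · intro x hx
    rw [Finset.mem_product, Finset.mem_powerset, Finset.mem_powerset] at hx
    obtain ⟨h1, h2⟩ := hx
    have hdis : Disjoint x.2 B := by
      rw [Finset.disjoint_left]; intro y hy hyB; exact (Finset.mem_compl.mp (h2 hy)) hyB
    ext1
    · simp only
      ext y; simp only [Finset.mem_inter, Finset.mem_union]
      constructor
      · rintro ⟨hy | hy, hyB⟩
        · exact hy
        · exact absurd hyB (Finset.disjoint_left.mp hdis hy)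
      · intro hy; exact ⟨Or.inl hy, h1 hy⟩
    · simp only
      ext y; simp only [Finset.mem_sdiff, Finset.mem_union]
      constructor
      · rintro ⟨hy | hy, hyB⟩
        · exact absurd (h1 hy) hyB
        · exact hy
      · intro hy; exact ⟨Or.inr hy, Finset.disjoint_left.mp hdis hy⟩
  · intro S _
    show F S = F (S ∩ B ∪ S \ B)
    rw [Finset.union_comm, Finset.sdiff_union_inter]

/-- **Block-Kronecker left inverse.** See the module docstring. -/
theorem blockInverse_mul (B : Finset (Fin h)) (eB eiB : Finset (Fin h) → Finset (Fin h) → ℂ)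
    (heB : ∀ P J, eB P J = eB P (J ∩ B))
    (hinv : ∀ Q Q', Q ⊆ B → Q' ⊆ B → ∑ P ∈ B.powerset, eiB Q P * eB P Q' = if Q = Q' then 1 else 0)
    (J J' : Finset (Fin h)) :
    ∑ S : Finset (Fin h),
      (eiB (J ∩ B) (S ∩ B) * (∏ x ∈ S \ B, (if x ∈ J then (1 : ℂ) else -1)) *
          (∏ x ∈ (S ∪ B)ᶜ, (if x ∈ J then (-1 : ℂ) else 2))) *
        (eB (S ∩ B) J' * ∏ x ∈ S \ B, (if x ∈ J' then (2 : ℂ) else 1))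
      = if J = J' then 1 else 0 := by
  classical
  rw [sum_split_block B]
  -- on S = P ∪ R with P ⊆ B, R ⊆ Bᶜ: S ∩ B = P, S \ B = R, (S ∪ B)ᶜ = Bᶜ \ R
  have hkey : ∀ P ∈ B.powerset, ∀ R ∈ Bᶜ.powerset,
      (P ∪ R) ∩ B = P ∧ (P ∪ R) \ B = R ∧ ((P ∪ R) ∪ B)ᶜ = Bᶜ \ R := by
    intro P hP R hR
    rw [Finset.mem_powerset] at hP hR
    refine ⟨?_, ?_, ?_⟩
    · ext y; simp only [Finset.mem_inter, Finset.mem_union]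
      constructor
      · rintro ⟨hy | hy, hyB⟩
        · exact hy
        · exact absurd hyB (Finset.mem_compl.mp (hR hy))
      · intro hy; exact ⟨Or.inl hy, hP hy⟩
    · ext y; simp only [Finset.mem_sdiff, Finset.mem_union]
      constructor
      · rintro ⟨hy | hy, hyB⟩
        · exact absurd (hP hy) hyB
        · exact hy
      · intro hy; exact ⟨Or.inr hy, Finset.mem_compl.mp (hR hy)⟩
    · ext y; simp only [Finset.mem_compl, Finset.mem_union, Finset.mem_sdiff, not_or]
      constructor
      · rintro ⟨⟨_, hyR⟩, hyB⟩; exact ⟨hyB, hyR⟩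
      · rintro ⟨hyB, hyR⟩; exact ⟨⟨fun hyP => hyB (hP hyP), hyR⟩, hyB⟩
  rw [Finset.sum_congr rfl fun P hP => Finset.sum_congr rfl fun R hR => by
    obtain ⟨h1, h2, h3⟩ := hkey P hP R hR
    rw [h1, h2, h3]]
  -- factor: (Σ_P eiB eB) * (Σ_R rest)
  have hfac : ∀ P ∈ B.powerset, ∀ R ∈ Bᶜ.powerset,
      (eiB (J ∩ B) P * (∏ x ∈ R, (if x ∈ J then (1 : ℂ) else -1)) * (∏ x ∈ Bᶜ \ R, (if x ∈ J then (-1 : ℂ) else 2))) *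
        (eB P J' * ∏ x ∈ R, (if x ∈ J' then (2 : ℂ) else 1))
      = (eiB (J ∩ B) P * eB P (J' ∩ B)) *
        ((∏ x ∈ R, ((if x ∈ J then (1 : ℂ) else -1) * (if x ∈ J' then (2 : ℂ) else 1))) *
          ∏ x ∈ Bᶜ \ R, (if x ∈ J then (-1 : ℂ) else 2)) := by
    intro P _ R _
    rw [heB P J', Finset.prod_mul_distrib]; ring
  rw [Finset.sum_congr rfl fun P hP => Finset.sum_congr rfl fun R hR => hfac P hP R hR]
  simp_rw [← Finset.mul_sum]
  rw [← Finset.sum_mul]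
  -- the rest factor: ∏_{x ∉ B} [x ∈ J ↔ x ∈ J']
  rw [← Finset.prod_add]
  have hfac2 : ∀ x : Fin h, ((if x ∈ J then (1 : ℂ) else -1) * (if x ∈ J' then (2 : ℂ) else 1) +
      (if x ∈ J then (-1 : ℂ) else 2)) = if (x ∈ J ↔ x ∈ J') then 1 else 0 := by
    intro x
    by_cases h1 : x ∈ J <;> by_cases h2 : x ∈ J' <;> simp [h1, h2] <;> norm_num
  rw [Finset.prod_congr rfl fun x _ => hfac2 x, Finset.prod_boole]
  rw [hinv _ _ Finset.inter_subset_right Finset.inter_subset_right]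
  -- combine: [J ∩ B = J' ∩ B] · [∀ x ∉ B, x ∈ J ↔ x ∈ J'] = [J = J']
  by_cases hJ : J = J'
  · subst hJ; simp
  · rw [if_neg hJ]
    by_cases hB : J ∩ B = J' ∩ B
    · rw [if_pos hB, one_mul, if_neg]
      intro hall
      apply hJ
      ext y
      by_cases hyB : y ∈ B
      · have := congrArg (fun s => y ∈ s) hB
        simp only [Finset.mem_inter, hyB, and_true, eq_iff_iff] at this
        exact this
      · exact hall y (Finset.mem_compl.mpr hyB)
    · rw [if_neg hB, zero_mul]

end CoStar

end Summit.ValiantsHypothesis.ValiantsHypothesis.Theorems.BarrierLever.HiddenStates
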